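import Literature.NumberTheory.Automorphic.Liu2021.AppendixC.RestOneLevelInvariantsHom
import Literature.NumberTheory.Automorphic.Liu2021.AppendixC.Thm415Pinned
import Literature.NumberTheory.Automorphic.Liu2021.AppendixC.EtaleBettiComparison
import HarnessLib

/-!
# Line `a3-liu418` (binder `hLiu418` → `HypLiu418`, [Liu 2021, Thm 4.18]): the ℓ-adic ITEM PREDICATES of Liu's proof, as tree declarations

Cell `hodgecm-mathlib`, fan A, rung A-III; Summits lane `CorCM/HypLiu418/`.  This file is §«The ℓ-adic items of Liu's proof of
[Thm 4.18]» (:178–:262) of the crux skeleton `A-plan/lines/a3-liu418.lean` v3 sha16 1b96ade3f8b6b529 (A-plan2; REF1 PASS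
2026-08-28T02:22Z), BYTE-FOR-BYTE, moved into the tree so that the four registered stub closures P (`stub_bettiThetaModel`,
junction per RULING (P)), F (`stub_faltingsIsotypic`, A-p17), S (`stub_galoisLabelSeparation`, A-p18), G (`stub_mainGaloisGlue`,
A-p19) can STATE their stub types by name: the items are a `structure` (`AdmTripleAll`) and four predicates with bodies
(`BettiThetaDecomposition`, `EtaleThetaDecomposition`, `FaltingsIsotypic`, `GaloisLabelSeparation`), generic over an Appendix-C
§4.2 datum `C`, its Albanese Hecke translates `T` and μ-uniform oscillator carriers `U` — a structure cannot be «unfolded verbatim»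
in a closure file, and per-closure copies would not be definitionally equal.  The skeleton's next revision imports this file in
place of its §EtaleItems (statements unchanged).  Definitions only: NOTHING is asserted, no named fact, no instance, no `sorry`;
HC_CM is proved only modulo the 7 printed citations until rung 0 closes.

## References
* [Liu2021] Y. Liu, *Fourier–Jacobi cycles and arithmetic relative trace formula*, Camb. J. Math. 9 (2021) / arXiv:2102.11518:
  Def. 4.11–4.12, Prop. 4.13 (FJcycle.tex l. 2110–2131), §4.3 (l. 2152–2160), Thm. 4.15 (l. 2177–2182), Thm. 4.18 proof
  (l. 2245–2266), Def. 4.5 (2).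
* [Faltings1983] G. Faltings, *Endlichkeitssätze für abelsche Varietäten über Zahlkörpern*, Satz 4 / Kor. 1.
* [SerreTate1968] J.-P. Serre, J. Tate, *Good reduction of abelian varieties*, §4 Thm. 5 (i).
-/

set_option autoImplicit false

noncomputable section

namespace Summit.HodgeConjecture.CorCM.Lines.A3Liu418

open scoped TensorProduct Matrix
open NumberField NumberField.InfinitePlace
open Literature.AlgebraicGeometry.Motives (CMType)
open Literature.AlgebraicGeometry.HodgeTheory
open Literature.NumberTheory.ComplexMultiplication
open Literature.NumberTheory.Automorphic
open Literature.NumberTheory.Automorphic.IdeleClassGroup (toHeckeCharacter isUnitary_toHeckeCharacter galConj)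
open Literature.NumberTheory.Automorphic.Liu2021 Literature.NumberTheory.Automorphic.Liu2021.AppendixC
open Literature.NumberTheory.Automorphic.Liu2021.AppendixC.RestOne
open Literature.RepresentationTheory Literature.RepresentationTheory.Liu2021
open scoped DirectSum

/-! ## The ℓ-adic items of Liu's proof of [Thm 4.18] (v3; generic over a §4.2 datum `C`, its Albanese Hecke translates `T`, oscillator carriers `U`) -/

section EtaleItems

open Literature.AlgebraicGeometry.Motives (AbelianVariety)
open Literature.AlgebraicGeometry.Motives.AbelianVariety (rationalTateModuleMap)
open Literature.AlgebraicGeometry.Liu2021 (IsAdmissibleElement)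

variable {F₀ E₀ : Type} [Field F₀] [NumberField F₀] [IsTotallyReal F₀] [Field E₀] [NumberField E₀] [Algebra F₀ E₀]
  [IsTotallyComplex E₀] [Algebra.IsQuadraticExtension F₀ E₀] [IsCMField E₀]
variable {P5 : PropC5Data F₀ E₀} {isotropicAt : ℕ → Prop} {C : Sec42Data P5 isotropicAt}
variable {L₀ : Type} [Field L₀] [NumberField L₀] [IsGalois ℚ L₀]

/-- **Labelled admissible oscillator triples** `(μ, ε, χ)` of a uniform family `U` over ALL conjugate-symplectic weight-one labels `μ` with `ε` `μ`-admissible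
(Def. 4.12) — the index set of [Prop 4.13]'s decomposition of the whole `H¹` (every label, not one `μ`). [cite: Liu2021, Prop. 4.13; Def. 4.12] -/
structure AdmTripleAll (U : UniformOmega C) : Type where
  /-- the label `μ` -/
  μ : Literature.NumberTheory.Automorphic.IdeleClassGroup E₀ →ₜ* Circle
  /-- `μ` is conjugate symplectic -/
  hμ : IdeleClassGroup.IsConjugateSymplectic E₀ μ
  /-- `μ` has weight one -/
  hw : IdeleClassGroup.HasWeight E₀ μ 1
  /-- the collection `ε` -/
  ε : U.Eps
  /-- `ε` is `μ`-admissible (Def. 4.12) -/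
  adm : ∃ e : E₀, IsAdmissibleElement E₀ hμ.cmType.1 e ∧ U.epsOf e = ε
  /-- the character `χ` -/
  χ : U.Chi

/-- **[Prop 4.13] for a Betti tower module** (Prop. 4.13 l. 2110–2131, read at the Albanese tower: `H¹(X_K, ℂ) = H¹(Alb X_K, ℂ)`): a
`𝔾`-equivariant decomposition `H ≅ ⊕_{(μ,ε,χ)} ω(μ,ε,χ)` over ALL labelled admissible triples of the family `U`, each ONCE.  A predicate on
`(U, H, rhoB)`. [cite: Liu2021, Prop. 4.13 (FJcycle.tex l. 2110–2131); Thm 4.18 proof (l. 2254–2257)] -/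
def BettiThetaDecomposition (U : UniformOmega C) (H : Type) [AddCommGroup H] [Module ℂ H] (rhoB : Representation ℂ C.G H) : Prop :=
  ∃ Ψ : H ≃ₗ[ℂ] (⨁ t : AdmTripleAll U, U.omega t.μ t.hμ t.ε t.χ),
    ∀ (g : C.G) (h : H) (t : AdmTripleAll U), Ψ (rhoB g h) t = U.rho t.μ t.hμ t.ε t.χ g (Ψ h t)

/-- **[Prop 4.13] + the comparison theorem at the ÉTALE tower, through `ι_ℓ`** (§4.3 l. 2152–2160 with Thm 4.18 proof l. 2254–2257): there is a
complex `ℂ[𝔾(𝔸_F^∞)]`-module `(H, rhoB)` («`H¹_{B,τ'}(A_∞, ℂ)`») with a Betti comparison `H ⊗_{ℂ,ι} ℚ_ℓ^{ac} ≃ ℚ_ℓ^{ac} ⊗ H¹_ét(A_∞)` intertwining `rhoB`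
with `X.rhoEt` (B-typ04's `BettiComparison`) and carrying the theta decomposition.  A predicate on `(U, X, ι)`.
[cite: Liu2021, Prop. 4.13; §4.3 (l. 2152–2160); Thm 4.18 proof (l. 2254–2257)] -/
def EtaleThetaDecomposition (U : UniformOmega C) (ℓ : ℕ) [Fact ℓ.Prime] (X : C.EtaleHeckeDatum ℓ)
    (ι' : ℂ ≃+* AlgebraicClosure ℚ_[ℓ]) : Prop :=
  ∃ (H : Type) (_ : AddCommGroup H) (_ : Module ℂ H) (rhoB : Representation ℂ C.G H),
    Nonempty (C.BettiComparison ℓ X H rhoB ι') ∧ BettiThetaDecomposition U H rhoB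

/-- **Faltings isotypic identification at the one object** (Thm 4.18 proof l. 2245–2263: «`Ω(μ) ⊗_{M_μ,ι_ℓ} ℚ_ℓ^{ac} = Hom(A_∞, A_μ)_ℚ ⊗ … ≃ Hom_{Gal}(ℚ_ℓ^{ac}·α, H¹_ét(A_∞ …))`»
by Faltings' isogeny theorem and the CM line `ℚ_ℓ^{ac}·α` of `H¹_ét(A_μ)` on which `M_μ` acts through `M_μ ↪ ℂ ≅_ι ℚ_ℓ^{ac}`): for the object `D_μ` of `𝒜(μ)` — (i) the eigenline
`cmEigenline ℓ A_μ M_μ i_μ ι` is a LINE (Serre–Tate §4 Thm 5 (i)); (ii) there is an `ι`-semilinear INJECTION `Ψ : ℂ ⊗_{M_μ} Ω(μ) → Hom_{ℚ_ℓ^{ac}}(ℚ_ℓ^{ac}·α, ℚ_ℓ^{ac} ⊗ H¹_ét(A_∞))`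
whose range is exactly the maps on which `Γ_E` acts compatibly with its eigencharacter on the line, and which intertwines `rhoΩ ⊗ 1` with post-composition by
`X.rhoEt`.  A predicate on `(T, D_μ-presentation, X, ι)`. [cite: Liu2021, Thm 4.18 proof (FJcycle.tex l. 2245–2263)] [cite: Faltings1983, Satz 4 / Kor. 1]
[cite: SerreTate1968, §4 Thm. 5 (i)] -/
def FaltingsIsotypic (T : C.HeckeTranslates) (φ : E₀ →ₐ[ℚ] L₀) (ι : L₀ →+* ℂ) {μ : Literature.NumberTheory.Automorphic.IdeleClassGroup E₀ →ₜ* Circle}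
    (hμ : IdeleClassGroup.IsConjugateSymplectic E₀ μ) (hw : IdeleClassGroup.HasWeight E₀ μ 1) (Car : Def45.Carriers E₀ μ)
    (ℓ : ℕ) [Fact ℓ.Prime] (X : C.EtaleHeckeDatum ℓ) (ι' : ℂ ≃+* AlgebraicClosure ℚ_[ℓ]) : Prop :=
  ∀ obj : RestOne.ObjOne φ ι hμ hw Car,
    Module.finrank (AlgebraicClosure ℚ_[ℓ])
        (cmEigenline ℓ (RestOne.AμOne φ ι hμ hw Car obj) (IdeleClassGroup.muAlgValueField E₀ μ) (RestOne.iOne φ ι hμ hw Car obj) ι') = 1 ∧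
    ∃ Ψ : (ℂ ⊗[fieldOfValues E₀ μ] RestOne.ΩOne C φ ι hμ hw Car) →ₛₗ[(ι' : ℂ →+* AlgebraicClosure ℚ_[ℓ])]
        (cmEigenline ℓ (RestOne.AμOne φ ι hμ hw Car obj) (IdeleClassGroup.muAlgValueField E₀ μ) (RestOne.iOne φ ι hμ hw Car obj) ι'
          →ₗ[AlgebraicClosure ℚ_[ℓ]] AlgebraicClosure ℚ_[ℓ] ⊗[ℚ_[ℓ]] C.etaleH1Tower ℓ),
      Function.Injective Ψ ∧
      Set.range Ψ =
        {h | ∀ (σ : Field.absoluteGaloisGroup E₀) (c : AlgebraicClosure ℚ_[ℓ]),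
          (∀ x ∈ cmEigenline ℓ (RestOne.AμOne φ ι hμ hw Car obj) (IdeleClassGroup.muAlgValueField E₀ μ) (RestOne.iOne φ ι hμ hw Car obj) ι',
              galoisH1Bar ℓ (RestOne.AμOne φ ι hμ hw Car obj) σ x = c • x) →
            ∀ y, (C.towerRep ℓ σ).baseChange (AlgebraicClosure ℚ_[ℓ]) (h y) = c • h y} ∧
      ∀ (g : C.G) (w : ℂ ⊗[fieldOfValues E₀ μ] RestOne.ΩOne C φ ι hμ hw Car) (y),
        Ψ ((T.rhoΩOne φ ι hμ hw Car g).baseChange ℂ w) y = (X.rhoEt g).baseChange (AlgebraicClosure ℚ_[ℓ]) (Ψ w y)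

/-- **Galois separation of the labels** (Thm 4.18 proof l. 2258–2266 with Thm 4.15 and Def 4.5 (2): the `ω(μ′,ε,χ)`-isotypic part of `ℚ_ℓ^{ac} ⊗ H¹_ét(A_∞)` carries the
Galois character `ι_ℓ ∘ μ′^{alg}`, the line `ℚ_ℓ^{ac}·α` of `H¹_ét(A_μ)` carries `ι_ℓ ∘ μ^{alg}`, and `μ′^{alg} = μ^{alg}` forces `μ′ = μ`): for every labelled admissible triple
`t = (μ′, ε, χ)` with `μ′ ≠ μ` and every NON-ZERO intertwiner `f ∈ Hom_{ℚ_ℓ^{ac}[𝔾]}(ι_ℓ ∘ ω_t, ℚ_ℓ^{ac} ⊗ H¹_ét(A_∞))`, some `σ ∈ Γ_E` acting by `c` on a non-zero vector of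
the line does NOT act by `c` on `f`.  A predicate on `(U, D_μ-presentation, X, ι)`; its discharge needs [Thm 4.15] at `μ′` and the injectivity of `μ ↦ μ^{alg}|_{Γ_E}`
(class field theory). [cite: Liu2021, Thm 4.15 (FJcycle.tex l. 2177–2182); Thm 4.18 proof (l. 2258–2266); Def. 4.5 (2) (l. 1952)] -/
def GaloisLabelSeparation (U : UniformOmega C) (φ : E₀ →ₐ[ℚ] L₀) (ι : L₀ →+* ℂ) {μ : Literature.NumberTheory.Automorphic.IdeleClassGroup E₀ →ₜ* Circle}
    (hμ : IdeleClassGroup.IsConjugateSymplectic E₀ μ) (hw : IdeleClassGroup.HasWeight E₀ μ 1) (Car : Def45.Carriers E₀ μ)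
    (ℓ : ℕ) [Fact ℓ.Prime] (X : C.EtaleHeckeDatum ℓ) (ι' : ℂ ≃+* AlgebraicClosure ℚ_[ℓ]) : Prop :=
  ∀ (obj : RestOne.ObjOne φ ι hμ hw Car) (t : AdmTripleAll U), t.μ ≠ μ →
    ∀ f ∈ X.omegaHom ι' (U.rho t.μ t.hμ t.ε t.χ), f ≠ 0 →
      ∃ (σ : Field.absoluteGaloisGroup E₀) (c : AlgebraicClosure ℚ_[ℓ]),
        (∃ x ∈ cmEigenline ℓ (RestOne.AμOne φ ι hμ hw Car obj) (IdeleClassGroup.muAlgValueField E₀ μ) (RestOne.iOne φ ι hμ hw Car obj) ι',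
            x ≠ 0 ∧ galoisH1Bar ℓ (RestOne.AμOne φ ι hμ hw Car obj) σ x = c • x) ∧
        ∃ w : U.omega t.μ t.hμ t.ε t.χ, (C.towerRep ℓ σ).baseChange (AlgebraicClosure ℚ_[ℓ]) (f w) ≠ c • f w

end EtaleItems

end Summit.HodgeConjecture.CorCM.Lines.A3Liu418

end
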